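import Summits.QuantumFields.BalabanUV.Beta.RowD1JointEndSymWardTables
import Summits.QuantumFields.BalabanUV.Beta.SymTablesAn1FirstOrder
import Summits.QuantumFields.BalabanUV.Beta.SymAveragingWardRootedStencils
import Summits.QuantumFields.BalabanUV.Beta.WardLocusWilsonEnd

/-!
# `BalabanUV.Beta.RowD1JointEndSymWardTablesAn1` — binder row D1: **THE LITERAL ROOT AT an1's FIRST-ORDER SYM TABLES** — the root of record
# `RowD1JointEndSymWardTables.d1Drift_JsB12Sym_of_an1Shift_wardTables_tableParity_reflLetters_D1Tel_D1Rep` (p268146) AT THE RECORD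
# `tabs := SymTablesAn1FirstOrder.symTablesAn1 3 Lc cΛ vh₂S mixFF …` (`V := symVhSAt ρ_c 3 Lc`, `H := symHessFFAt ρ_c Lc`, `M j := M1Of 3 Lc H cΛ j`) with SIX
# hW-SIDE LETTERS DISCHARGED BY NAME: (S-V)⁰⁴ `hVd04` (an1-g42's S2c-lite `SymAveragingWardRootedStencils.divV_symVhSAt_eq_conjV_ctr`), (V-ff0) `hV0`
# (`symVhSAt_hV0_ctr`), (M-H) `hM1` (`rfl`), (V-p)(H-p) (`trK_symTablesAn1_V` ∕ `_H`), AND (T2-W) `hWil`∕`hWil''` with `RW = RW″ = 0` (the comb's COLOUR-FREE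
# level-0 Wilson Ward law at the centred root, `WilsonWardColourFree.hWil_wilson_TW₃_su` ∕ `hWil''_wilson_TW₃_su`, pattern `WardLocusWilsonEnd`; `2 ≤ N`)
# (β sub-cell, BINDER-OWNERS row D1 OWNER `b2b-balaban-beta-an2`, gen 30; brick (N6a), INTENT journal [AN2-G30-ONLINE])

HONEST FRAMING (cell charter, verbatim): «discharging BetaPertH makes Bałaban's UV stability UNCONDITIONAL — a real constructive-QFT result; it is
NOT the continuum limit and NOT the Clay problem.»  HONEST DEPENDENCY: continuum YM on T⁴ ⇐ BetaPertH ∧ nine spine estimates (0/9 proved);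
BetaPertH ⇐ (D1) ∧ (D4) ∧ CAP+tail; G-an2-4 gates asym, D1 and NE2/3/4.
DERIVED cell leaf ([folklore] wiring BY NAME).  No statement of Bałaban's papers, no `[cite:]`, no `Prop` fact, no `def`.  EVERY hypothesis below is a displayed
BINDER.  LOCATED (this gen): the (T2-W) letter displayed by p268146 is NOT a value question about an1's tables — it is the comb's level-0 Wilson law for the ONE
table `T_W := (8N²)⁻¹ • wsym22 N` under the literal's own pin `cE₂ = Lc⁸`, at the centred root `ctr 4 Lc = toSite (ctrOff 4 Lc)`, a tree THEOREM since 2026-08-20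
(an3-g32 ∕ leaf-05-g6 `WilsonWardColourFree`, over leaf-09-g4's `WilsonBiStencilWardSocket`).  WHAT REMAINS DISPLAYED: `2 ≤ N`; hW side = the SECOND-ORDER
TABLE letters (T2-B) (both slots, levels 0 and j+1: `vh₂S` against an1's `symVhSAt ρ_c`) and (T2-M₂) (`M2Of 3 Lc mixFF j` against `M1Of 3 Lc (symHessFFAt ρ_c Lc) cΛ
j`) with remainders `RB RB″ RM` (classes, one rate per level; row parities) and the structure letters (LB)(Lmix)(TB)(Tmix) of the two second-order tables — an1's
TABLES-SYM steps S2b+, NOT typed at the time of writing; hR side = (V-r)×3 (H-r) NOW ABOUT an1's CONCRETE `symVhSAt ρ_c` ∕ `symHessFFAt ρ_c` (with the pinned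
contact generator), `γ`, (Wr-conj-c) with `X₂`, `Wc`, `hcomp`; then D1Tel, D1Rep, the printed B5 facts and the window.  HONEST: composition by name; root-level
classes 0∕5 (no class is EMPTY yet: hW keeps (T2-B)(T2-M₂)); tables in tree: first order 3∕3 (an1 S2A), second order 0∕2; NOT D1, NOT `BetaPertH`, NOT continuum,
NOT Clay.
Provenance: β sub-cell, unit beta-an2 gen 30, 2026-08-21 (v1); over `RowD1JointEndSymWardTables`, `SymTablesAn1FirstOrder`, `SymAveragingWardRootedStencils`
(an1-g42, courier an2-g30), `WilsonWardColourFree` ∕ `WardLocusWilsonEnd` BY NAME; no existing file touched.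
-/

noncomputable section

open Finset
open scoped BigOperators
open Literature.MathematicalPhysics.QuantumFieldTheory
open Literature.MathematicalPhysics.QuantumFieldTheory.Balaban1983to89
open Literature.MathematicalPhysics.QuantumFieldTheory.Balaban1983to89.Beta
open Literature.MathematicalPhysics.QuantumFieldTheory.Balaban1983to89.Beta.VectorTailsLoc (fam kfam)
open Literature.MathematicalPhysics.QuantumFieldTheory.Balaban1983to89.Beta.VectorLegVolumeAdapter (MvE)
open ExpKernelCalculus (MKer BiLoc VertexFamily comp tr tadpole shiftK)
open PolarizationSign (reflSign WardTransversal AxisReflectionCovariant)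
open KernelReflection (refK)
open ResolventReflection (bref Φ)
open AffineAveraging (box toSite)
open AveragingContoursRooted (ctr ctrOff ctrOff_mem_box)
open OneStepResolventKernel (Fib LocStencil JetData)
open OneStepKernelFamily (KInvStep vertexOfK TbalOf flipK D1Tel D1Rep D1Drift)
open KernelWard (divV divW)
open StepJetData (mfNeg wilsonA)
open BalabanStepJetsSucc (wVH)
open SecondOrderResponse (dM LocStencilFM)
open BalabanCompositeJets (LocStencil₂)
open BalabanStepW2 (M2Of wB2)
open WilsonBiStencil (wilsonW₂)
open WilsonVertex2Sym (wsym22)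
open Summit.QuantumFields.BalabanUV.Beta.TameKernelCalculus
open Summit.QuantumFields.BalabanUV.Beta.ChartConjugation (conjV conjW)
open Summit.QuantumFields.BalabanUV.Beta.ChartConjugationDefectEnd (conjDefect)
open Summit.QuantumFields.BalabanUV.Beta.AxialDressingRooted (one_le_of_neZero)
open Summit.QuantumFields.BalabanUV.Beta.SymmetrisedDressingKernel (coDressKSymAt)
open Summit.QuantumFields.BalabanUV.Beta.AveragingWardRootedStencils (legInd)
open Summit.QuantumFields.BalabanUV.Beta.SymmetrisedStepJets (SymTables Gsym SsymOf SpureSymOf JsB12Sym0 JsB12Sym)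
open Summit.QuantumFields.BalabanUV.Beta.SpineRooted (M1Of)
open Summit.QuantumFields.BalabanUV.Beta.SymShiftedSpread (bhKStepSh)
open Summit.QuantumFields.BalabanUV.Beta.BorderedHessian (sgnK bhK stepScale diagK)
open Summit.QuantumFields.BalabanUV.Beta.E3ContactGenerator (ctGenM)
open Summit.QuantumFields.BalabanUV.Beta.DshAn1 (Dsh linSym04At)
open Summit.QuantumFields.BalabanUV.Beta.SpineRecursiveParity (parityOdd_zero)
open Summit.QuantumFields.BalabanUV.Beta.WardLocusWilsonEnd (locStencil_zero_apply)
open Summit.QuantumFields.BalabanUV.Beta.WilsonWardColourFree (hWil_wilson_TW₃_su hWil''_wilson_TW₃_su)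
open Summit.QuantumFields.BalabanUV.Beta.SymAveragingHessianCounts (symVhSAt symHessFFAt symVhSAt_hV0_ctr)
open Summit.QuantumFields.BalabanUV.Beta.SymAveragingWardRootedStencils (divV_symVhSAt_eq_conjV_ctr)
open Summit.QuantumFields.BalabanUV.Beta.SymTablesAn1FirstOrder (symTablesAn1 trK_symTablesAn1_V trK_symTablesAn1_H)
open Summit.QuantumFields.BalabanUV.Beta.RowD1JointEndSymWardTables (d1Drift_JsB12Sym_of_an1Shift_wardTables_tableParity_reflLetters_D1Tel_D1Rep)

namespace Summit.QuantumFields.BalabanUV.Beta.RowD1JointEndSymWardTablesAn1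

variable {Lc : ℕ} [NeZero Lc]

/-- **ROW D1 — THE LITERAL ROOT AT an1's FIRST-ORDER SYM TABLES (`symTablesAn1 3 Lc cΛ vh₂S mixFF …`), SIX hW LETTERS DISCHARGED**:
`RowD1JointEndSymWardTables.d1Drift_JsB12Sym_of_an1Shift_wardTables_tableParity_reflLetters_D1Tel_D1Rep` with (S-V)⁰⁴ supplied by an1's
`divV_symVhSAt_eq_conjV_ctr`, (V-ff0) by `symVhSAt_hV0_ctr`, (M-H) by `rfl`, (V-p)(H-p) by `trK_symTablesAn1_V`∕`_H`, and the level-0 Wilson letters (T2-W) (both slots,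
`RW = RW″ = 0`) by `WilsonWardColourFree.hWil_wilson_TW₃_su` ∕ `hWil''_wilson_TW₃_su` (`2 ≤ N`, pin `cE₂ = Lc⁸`, root `ctrOff 4 Lc`).  Every other binder VERBATIM, now
about an1's concrete first-order tables and the two displayed second-order tables.  HONEST: composition by name; 0∕5 root-level classes; second-order tables 0∕2;
NOT D1. -/
theorem d1Drift_JsB12Sym_an1Tables_of_bordMixLetters_reflLetters_D1Tel_D1Rep (hLc : Odd Lc) (hL2 : 2 ≤ Lc) {N : ℕ} (hN : 2 ≤ N) (cΛ cB : ℝ)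
    -- the two SECOND-ORDER sym tables and their structure letters (LB)(Lmix)(TB)(Tmix) — an1's TABLES-SYM steps S2b+, displayed
    (vh₂S : Fin (3 + 1) → (Fin (3 + 1) → ℤ) → Fin (3 + 1) → (Fin (3 + 1) → ℤ) → MKer (3 + 1) (Fib 3))
    (mixFF : Fin (3 + 1) → (Fin (3 + 1) → ℤ) → Fin (3 + 1) → (Fin (3 + 1) → ℤ) → MKer (3 + 1) (Fib 3))
    (hB : ∃ C δ : ℝ, 0 < δ ∧ LocStencil₂ vh₂S C δ) (hmix : ∃ C δ : ℝ, 0 < δ ∧ LocStencilFM Lc mixFF C δ)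
    (hBt : ∀ (κ : Fin (3 + 1)) (u : Fin (3 + 1) → ℤ) (κ' : Fin (3 + 1)) (u' t : Fin (3 + 1) → ℤ),
      vh₂S κ (u + (Lc : ℤ) • t) κ' (u' + (Lc : ℤ) • t) = shiftK (-((Lc : ℤ) • t)) (vh₂S κ u κ' u'))
    (hmixt : ∀ (κ : Fin (3 + 1)) (u : Fin (3 + 1) → ℤ) (μ : Fin (3 + 1)) (w t : Fin (3 + 1) → ℤ),
      mixFF κ (u + (Lc : ℤ) • t) μ (w + t) = shiftK (-((Lc : ℤ) • t)) (mixFF κ u μ w))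
    -- the second-order TABLE letters' remainders, their classes (one rate per level) and row parities
    (RB RB'' : ℕ → (Fin 4 → ℤ) → Fin 4 → (Fin 4 → ℤ) → MKer 4 (Fib 3))
    (RM : ℕ → (Fin 4 → ℤ) → Fin 4 → (Fin 4 → ℤ) → MKer 4 (Fib 3))
    (hcls0 : ∃ C δ : ℝ, 0 < δ ∧ (∀ Y, LocStencil (RB 0 Y) C δ) ∧ (∀ Y, LocStencil (RB'' 0 Y) C δ) ∧ (∀ y, VertexFamily (RM 0 y) Lc C δ))
    (hclsS : ∀ j : ℕ, ∃ C δ : ℝ, 0 < δ ∧ (∀ Y, LocStencil (RB (j + 1) Y) C δ) ∧ (∀ Y, LocStencil (RB'' (j + 1) Y) C δ) ∧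
      (∀ y, VertexFamily (RM (j + 1) y) Lc C δ))
    (hRBp : ∀ j Y κ u, trK (RB j Y κ u) = -sgnK (RB j Y κ u)) (hRB''p : ∀ j Y κ u, trK (RB'' j Y κ u) = -sgnK (RB'' j Y κ u))
    (hRMp : ∀ j y ρ' w, trK (RM j y ρ' w) = -sgnK (RM j y ρ' w))
    -- (T2-B) the Ward law of the second-order border table `vh₂S` against an1's `symVhSAt ρ_c`, both slots, level 0 and level j+1
    (hBord0 : ∀ (Y : Fin 4 → ℤ) (κ' : Fin 4) (u' : Fin 4 → ℤ),
      (stepScale 3 Lc 0 * (Lc : ℝ) ^ (3 + 1))⁻¹ • ∑ v ∈ box (3 + 1) Lc, divV (fun κ u => cB • vh₂S κ u κ' u') ((Lc : ℤ) • Y + toSite v) =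
        comp ((-((Lc : ℝ) ^ (3 + 1) * (1 / 2) * (Lc : ℝ) ^ (3 + 1))) • symVhSAt (ctr 4 Lc) 3 Lc rfl κ' u')
            (diagK ((1 / 2 : ℝ) • ∑ v ∈ box (3 + 1) Lc, legInd (ctr (3 + 1) Lc) ((Lc : ℤ) • Y + toSite v)))
          - comp (diagK ((1 / 2 : ℝ) • ∑ v ∈ box (3 + 1) Lc, legInd (ctr (3 + 1) Lc) ((Lc : ℤ) • Y + toSite v)))
            ((-((Lc : ℝ) ^ (3 + 1) * (1 / 2) * (Lc : ℝ) ^ (3 + 1))) • symVhSAt (ctr 4 Lc) 3 Lc rfl κ' u') + RB 0 Y κ' u')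
    (hBord0'' : ∀ (Y : Fin 4 → ℤ) (κ : Fin 4) (u : Fin 4 → ℤ),
      (stepScale 3 Lc 0 * (Lc : ℝ) ^ (3 + 1))⁻¹ • ∑ v ∈ box (3 + 1) Lc, divV (fun κ' u' => cB • vh₂S κ u κ' u') ((Lc : ℤ) • Y + toSite v) =
        comp ((-((Lc : ℝ) ^ (3 + 1) * (1 / 2) * (Lc : ℝ) ^ (3 + 1))) • symVhSAt (ctr 4 Lc) 3 Lc rfl κ u)
            (diagK ((1 / 2 : ℝ) • ∑ v ∈ box (3 + 1) Lc, legInd (ctr (3 + 1) Lc) ((Lc : ℤ) • Y + toSite v)))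
          - comp (diagK ((1 / 2 : ℝ) • ∑ v ∈ box (3 + 1) Lc, legInd (ctr (3 + 1) Lc) ((Lc : ℤ) • Y + toSite v)))
            ((-((Lc : ℝ) ^ (3 + 1) * (1 / 2) * (Lc : ℝ) ^ (3 + 1))) • symVhSAt (ctr 4 Lc) 3 Lc rfl κ u) + RB'' 0 Y κ u)
    (hBordS : ∀ (j : ℕ) (Y : Fin 4 → ℤ) (κ' : Fin 4) (u' : Fin 4 → ℤ),
      (stepScale 3 Lc (j + 1) * (Lc : ℝ) ^ (3 + 1))⁻¹ • ∑ v ∈ box (3 + 1) Lc, divV (fun κ u => (cB * wB2 3 Lc (j + 1)) • vh₂S κ u κ' u') ((Lc : ℤ) • Y + toSite v) =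
        comp (((-((Lc : ℝ) ^ (3 + 1) * (1 / 2) * (Lc : ℝ) ^ (3 + 1))) * wVH 3 Lc (j + 1)) • symVhSAt (ctr 4 Lc) 3 Lc rfl κ' u')
            (diagK ((1 / 2 : ℝ) • ∑ v ∈ box (3 + 1) Lc, legInd (ctr (3 + 1) Lc) ((Lc : ℤ) • Y + toSite v)))
          - comp (diagK ((1 / 2 : ℝ) • ∑ v ∈ box (3 + 1) Lc, legInd (ctr (3 + 1) Lc) ((Lc : ℤ) • Y + toSite v)))
            (((-((Lc : ℝ) ^ (3 + 1) * (1 / 2) * (Lc : ℝ) ^ (3 + 1))) * wVH 3 Lc (j + 1)) • symVhSAt (ctr 4 Lc) 3 Lc rfl κ' u') + RB (j + 1) Y κ' u')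
    (hBordS'' : ∀ (j : ℕ) (Y : Fin 4 → ℤ) (κ : Fin 4) (u : Fin 4 → ℤ),
      (stepScale 3 Lc (j + 1) * (Lc : ℝ) ^ (3 + 1))⁻¹ • ∑ v ∈ box (3 + 1) Lc, divV (fun κ' u' => (cB * wB2 3 Lc (j + 1)) • vh₂S κ u κ' u') ((Lc : ℤ) • Y + toSite v) =
        comp (((-((Lc : ℝ) ^ (3 + 1) * (1 / 2) * (Lc : ℝ) ^ (3 + 1))) * wVH 3 Lc (j + 1)) • symVhSAt (ctr 4 Lc) 3 Lc rfl κ u)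
            (diagK ((1 / 2 : ℝ) • ∑ v ∈ box (3 + 1) Lc, legInd (ctr (3 + 1) Lc) ((Lc : ℤ) • Y + toSite v)))
          - comp (diagK ((1 / 2 : ℝ) • ∑ v ∈ box (3 + 1) Lc, legInd (ctr (3 + 1) Lc) ((Lc : ℤ) • Y + toSite v)))
            (((-((Lc : ℝ) ^ (3 + 1) * (1 / 2) * (Lc : ℝ) ^ (3 + 1))) * wVH 3 Lc (j + 1)) • symVhSAt (ctr 4 Lc) 3 Lc rfl κ u) + RB'' (j + 1) Y κ u)
    -- (T2-M₂) the Ward law of the mixed table `M2Of 3 Lc mixFF j` against `M1Of 3 Lc (symHessFFAt ρ_c Lc) cΛ j`, every level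
    (hM₂ : ∀ (j : ℕ) (y : Fin 4 → ℤ) (ρ' : Fin 4) (w : Fin 4 → ℤ),
      (stepScale 3 Lc j * (Lc : ℝ) ^ (3 + 1))⁻¹ • ∑ v ∈ box (3 + 1) Lc, divV (fun κ u => M2Of 3 Lc mixFF j κ u ρ' w) ((Lc : ℤ) • y + toSite v) =
        comp (M1Of 3 Lc (symHessFFAt (ctr 4 Lc) Lc) cΛ j ρ' w) (diagK ((1 / 2 : ℝ) • ∑ v ∈ box (3 + 1) Lc, legInd (ctr (3 + 1) Lc) ((Lc : ℤ) • y + toSite v)))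
          - comp (diagK ((1 / 2 : ℝ) • ∑ v ∈ box (3 + 1) Lc, legInd (ctr (3 + 1) Lc) ((Lc : ℤ) • y + toSite v))) (M1Of 3 Lc (symHessFFAt (ctr 4 Lc) Lc) cΛ j ρ' w)
          + RM j y ρ' w)
    -- hR, first order: the REFLECTION letters (V-r)(H-r) of an1's concrete first-order sym tables (pinned contact generator) — an1's reflection step, displayed
    (hVfm : ∀ (α κ' : Fin 4) (u x z : Fin 4 → ℤ) (β m : Fin 4), symVhSAt (ctr 4 Lc) 3 Lc rfl κ' (bref α κ' u) x z (Sum.inl β) (Sum.inr m) =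
      (reflSign α κ' • refK (Φ (d := 3) Lc α) (symVhSAt (ctr 4 Lc) 3 Lc rfl κ' u + conjV (bhK (d := 3) Lc + Dsh Lc)
        ((((Lc : ℝ) ^ 4)⁻¹) • diagK (ctGenM 3 (bhK Lc + Dsh Lc) α Lc κ' u)))) x z (Sum.inl β) (Sum.inr m))
    (hVmf : ∀ (α κ' : Fin 4) (u x z : Fin 4 → ℤ) (m β : Fin 4), symVhSAt (ctr 4 Lc) 3 Lc rfl κ' (bref α κ' u) x z (Sum.inr m) (Sum.inl β) =
      (reflSign α κ' • refK (Φ (d := 3) Lc α) (symVhSAt (ctr 4 Lc) 3 Lc rfl κ' u + conjV (bhK (d := 3) Lc + Dsh Lc)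
        ((((Lc : ℝ) ^ 4)⁻¹) • diagK (ctGenM 3 (bhK Lc + Dsh Lc) α Lc κ' u)))) x z (Sum.inr m) (Sum.inl β))
    (hVmm : ∀ (α κ' : Fin 4) (u x z : Fin 4 → ℤ) (m m' : Fin 4), symVhSAt (ctr 4 Lc) 3 Lc rfl κ' (bref α κ' u) x z (Sum.inr m) (Sum.inr m') =
      (reflSign α κ' • refK (Φ (d := 3) Lc α) (symVhSAt (ctr 4 Lc) 3 Lc rfl κ' u + conjV (bhK (d := 3) Lc + Dsh Lc)
        ((((Lc : ℝ) ^ 4)⁻¹) • diagK (ctGenM 3 (bhK Lc + Dsh Lc) α Lc κ' u)))) x z (Sum.inr m) (Sum.inr m'))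
    (hHr : ∀ (α μ : Fin 4) (y : Fin 4 → ℤ),
      symHessFFAt (ctr 4 Lc) Lc μ (bref α μ y) = reflSign α μ • refK (Φ (d := 3) Lc α) (symHessFFAt (ctr 4 Lc) Lc μ y))
    -- the first-order contact coefficient, displayed
    (γ : ℕ → ℝ) (hγ : ∀ j, γ j = -((Lc : ℝ) ^ 8 / 2) * wVH 3 Lc j / (stepScale 3 Lc j * (Lc : ℝ) ^ 4))
    -- hR, second order, with the PINNED first-order contacts
    (X₂ Wc : ℕ → Fin 4 → Fin 4 → (Fin 4 → ℤ) → Fin 4 → (Fin 4 → ℤ) → MKer 4 (Fib 3))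
    (hX₂ : ∀ j α μ y ν y', Loc (X₂ j α μ y ν y')) (hWc : ∀ j α μ y ν y', Loc (Wc j α μ y ν y'))
    (hWrC : ∀ (j : ℕ) (α μ : Fin 4) (y : Fin 4 → ℤ) (ν : Fin 4) (y' : Fin 4 → ℤ),
      (JsB12Sym0 hLc N (symTablesAn1 3 Lc cΛ vh₂S mixFF hB hmix hBt hmixt) cΛ cB j).W μ (bref α μ y) ν (bref α ν y') =
        (reflSign α μ * reflSign α ν) • refK (Φ Lc α) ((JsB12Sym0 hLc N (symTablesAn1 3 Lc cΛ vh₂S mixFF hB hmix hBt hmixt) cΛ cB j).W μ y ν y' +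
        conjW (bhKStepSh 3 Lc (Dsh Lc) j)
          (vertexOfK (coDressKSymAt (toSite (ctrOff 4 Lc)) Lc (KInvStep (d := 3) Lc j)) Lc (JsB12Sym0 hLc N (symTablesAn1 3 Lc cΛ vh₂S mixFF hB hmix hBt hmixt) cΛ cB j).S μ y)
          (vertexOfK (coDressKSymAt (toSite (ctrOff 4 Lc)) Lc (KInvStep (d := 3) Lc j)) Lc (JsB12Sym0 hLc N (symTablesAn1 3 Lc cΛ vh₂S mixFF hB hmix hBt hmixt) cΛ cB j).S ν y')
          (vertexOfK (coDressKSymAt (toSite (ctrOff 4 Lc)) Lc (KInvStep (d := 3) Lc j)) Lc (fun κ u => γ j • diagK (ctGenM 3 (bhK Lc + Dsh Lc) α Lc κ u)) μ y)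
          (vertexOfK (coDressKSymAt (toSite (ctrOff 4 Lc)) Lc (KInvStep (d := 3) Lc j)) Lc (fun κ u => γ j • diagK (ctGenM 3 (bhK Lc + Dsh Lc) α Lc κ u)) ν y')
          (X₂ j α μ y ν y')
          + Wc j α μ y ν y'))
    (hcomp : ∀ (j : ℕ) (α μ : Fin 4) (y : Fin 4 → ℤ) (ν : Fin 4) (y' : Fin 4 → ℤ),
      (1 / 2 : ℝ) * tadpole (coDressKSymAt (toSite (ctrOff 4 Lc)) Lc (KInvStep (d := 3) Lc j)) (Wc j α μ y ν y')
        + conjDefect (coDressKSymAt (toSite (ctrOff 4 Lc)) Lc (KInvStep (d := 3) Lc j)) (bhKStepSh 3 Lc (Dsh Lc) j)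
            (vertexOfK (coDressKSymAt (toSite (ctrOff 4 Lc)) Lc (KInvStep (d := 3) Lc j)) Lc (JsB12Sym0 hLc N (symTablesAn1 3 Lc cΛ vh₂S mixFF hB hmix hBt hmixt) cΛ cB j).S μ y)
            (vertexOfK (coDressKSymAt (toSite (ctrOff 4 Lc)) Lc (KInvStep (d := 3) Lc j)) Lc (JsB12Sym0 hLc N (symTablesAn1 3 Lc cΛ vh₂S mixFF hB hmix hBt hmixt) cΛ cB j).S ν y')
            (vertexOfK (coDressKSymAt (toSite (ctrOff 4 Lc)) Lc (KInvStep (d := 3) Lc j)) Lc (fun κ u => γ j • diagK (ctGenM 3 (bhK Lc + Dsh Lc) α Lc κ u)) μ y)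
            (vertexOfK (coDressKSymAt (toSite (ctrOff 4 Lc)) Lc (KInvStep (d := 3) Lc j)) Lc (fun κ u => γ j • diagK (ctGenM 3 (bhK Lc + Dsh Lc) α Lc κ u)) ν y')
            (X₂ j α μ y ν y') = 0)
    -- the route theorem's own binders, verbatim
    (a : ℝ) (ha : 0 < a)
    (h12 : B5.Prop12Printed (fam (fun i : ℕ+ × ℕ => ((i.1 : ℕ+) : ℕ)) (fun i => i.1.pos) MvE a ha))
    (h126 : B5.Kernel126_127Printed (kfam (fun i : ℕ+ × ℕ => ((i.1 : ℕ+) : ℕ)) MvE))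
    {L : Type*} {SL : Finset L} (hSL : SL.Nonempty) (k : L → Fin 4) {μ ν : Fin 4} (hμν : μ ≠ ν) {Nc : ℝ} (hNc : Nc ≠ 0)
    (Jc : ∀ m : ℕ, JetData 3 (Lc ^ m))
    (htel : D1Tel Lc (JsB12Sym hLc N (symTablesAn1 3 Lc cΛ vh₂S mixFF hB hmix hBt hmixt) cΛ cB) Jc)
    {cc : ℝ} {Mw' : ℕ → ℕ} (hc : 1 ≤ cc) (hMwin : ∀ L : ℕ, 2 ≤ L → 1 ≤ Mw' L ∧ (L : ℝ) ≤ cc * Mw' L) (hML : ∀ L : ℕ, 2 ≤ L → Mw' L ≤ L)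
    (hrep : D1Rep Lc Jc Nc μ ν a SL k) :
    D1Drift Lc (JsB12Sym hLc N (symTablesAn1 3 Lc cΛ vh₂S mixFF hB hmix hBt hmixt) cΛ cB) Nc μ ν := by
  obtain ⟨C0, δ0, hδ0, hRBl, hRB''l, hRMl⟩ := hcls0
  have hC0 : 0 ≤ C0 := (hRMl 0 0 0).nonneg (Sum.inl 0)
  exact d1Drift_JsB12Sym_of_an1Shift_wardTables_tableParity_reflLetters_D1Tel_D1Rep hLc hL2 N (symTablesAn1 3 Lc cΛ vh₂S mixFF hB hmix hBt hmixt) cΛ cB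
    (divV_symVhSAt_eq_conjV_ctr (d := 3) (one_le_of_neZero Lc))
    (fun _ _ _ => rfl)
    (trK_symTablesAn1_V cΛ vh₂S mixFF hB hmix hBt hmixt)
    (trK_symTablesAn1_H cΛ vh₂S mixFF hB hmix hBt hmixt)
    0 0 RB RB'' RM
    ⟨C0, δ0, hδ0, locStencil_zero_apply hC0, locStencil_zero_apply hC0, hRBl, hRB''l, hRMl⟩ hclsS
    (fun _ _ _ => parityOdd_zero) (fun _ _ _ => parityOdd_zero) hRBp hRB''p hRMp
    (hWil_wilson_TW₃_su hN Lc (ctrOff 4 Lc) rfl) (hWil''_wilson_TW₃_su hN Lc (ctrOff 4 Lc) rfl)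
    hBord0 hBord0'' hBordS hBordS'' hM₂ hVfm hVmf hVmm (symVhSAt_hV0_ctr Lc) hHr γ hγ X₂ Wc hX₂ hWc hWrC hcomp
    a ha h12 h126 hSL k hμν hNc Jc htel hc hMwin hML hrep

end Summit.QuantumFields.BalabanUV.Beta.RowD1JointEndSymWardTablesAn1

end
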